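import Summits.QuantumFields.BalabanUV.T4Continuum.Support.NE9AnalyticFixedPoint
import Literature.MathematicalPhysics.QuantumFieldTheory.Balaban1983to89.T4FixedPointResponse
import Literature.Analysis.Complex.OsgoodProofs

/-!
# NE9B11SolutionAnalytic — THE SOLUTION OF B11's CONTRACTION (116)/(175) IS FRÉCHET-ANALYTIC IN THE BANACH DATUM 𝔄 = H₁B, AND THE
# (174) ∘ (47) COMPOSITE MEETS THE `cur` SPECIES' BACKGROUND-MAP BINDERS (Ψ1)–(Ψ3) (route R2′ «`cur` by B11's displayed contractions» of
# `t4/ROUTES-NE9.md` v2, instantiation step after B1⁺ = p248333 ∕ B4′ = p248585; cell `pub-balaban`, T4-DAG §2 node U3 ∕ §6 NE9; BINDER row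
# NE9 OWNER lineage `b2b-balaban-t4-ne9-p1`, generation 59; Summits-side NEW work, nothing printed asserted)

HONEST FRAMING (T4-DAG PAGE 1).  Rung (B)+1 of the FINITE-VOLUME T⁴ programme — NOT infinite volume, NOT a mass gap, NOT the Clay
problem.  NE9 (`T4OutputRate.NE9` ∧ `FadingMemory`) is a cell NEW ESTIMATE, NOT PRINTED in [I] = [Balaban1987RG1] (CMP **109**), [II] =
[Balaban1988RG2Cluster] (CMP **116**), and NOT PROVED here («NE9 ⇐ the named binders»; spine PROVED 0∕9).  HONEST DEPENDENCY (cell line,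
verbatim): continuum YM on T⁴ ⇐ BetaPertH ∧ nine spine estimates (0/9 proved); BetaPertH ⇐ (D1) ∧ (D4) ∧ CAP+tail; G-an2-4 gates asym, D1
and NE2/3/4.  MECHANISM ONLY, over the ABSTRACT complex Banach spaces of the tree's contraction scheme `B11Prop6Scheme` (configurations `𝒴`
with the norm of (115), currents `𝒵`; `𝒢 = 𝔊`, `Λ`, `W = (δ/δA′)V`, `J`, `H₁`, the Sect. C map `T = (47)` are DATA; their norm bounds and
the scheme's smallness conditions (117)–(121) are HYPOTHESES).  Nothing of [15] = [Balaban1985Variational] (CMP **102**) is asserted;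
nothing is constructed on lattice carriers (socket C19′).

WHY (route R2′, `t4/ROUTES-NE9.md` v2 §L1.2).  The species-(a) datum `cur` of the row's END (T31 `NE9EndOfRecordPoints`) is fed, for curves of
Bałaban's shape `σ′ ↦ Ψ_X(σ′ • B)`, by `NE9CurveFromBackgroundMap` from THREE TYPE FACTS about the background map `Ψ_X`: (Ψ1) `DifferentiableOn ℂ`
(FRÉCHET) on the field ball, (Ψ2) `MapsTo` the field ball into the chart ball, (Ψ3) `Ψ_X 0 = 0`.  In print the chart is [15] Sect. G
(174)–(175): *«𝓗 = 𝒜₁ + H₁B − HD(𝒜₁ + H₁B), (174) where 𝒜₁ satisfies the equation 𝒜₁ + 𝔊((δ/δA′)V)(𝒜₁ + H₁B) = 0, (175)»* (p. 305),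
*«The function 𝒜₁, as a solution of Eq. (175), is an analytic function of H₁B, hence of B»* (p. 306), Prop. 6 p. 296 *«the solution is an
analytic function of 𝔄 … the solution can be constructed as a uniform limit of a sequence of successive approximations»*.  The tree's
`B11Prop6Scheme.solution_analytic` (and lit-balaban's chart object `B11Eq174Chart`, p249182) give holomorphy along ONE-complex-parameter
families only; (Ψ1) and the Schwarz∕Cauchy steps of `NE9CurveFromBackgroundMap` (`room_compCur`, `lip_compCur`) need holomorphy in the
BANACH variable.  THIS FILE supplies it from the lineage's Banach-parameter fixed-point theorem
`NE9AnalyticFixedPoint.exists_analyticOnNhd_fixedPt_section` (leaf-03 g37, p248333):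
* §1 `analyticOnNhd_mapT` — `(𝔄, X) ↦ mapT 𝒢 Λ W J 𝔄 X` is jointly analytic where `‖X + 𝔄‖ < a₃`, for `W` analytic on that ball;
  **`exists_analyticOnNhd_solution`** — under EXACTLY the hypotheses of `B11Prop6Scheme.existsUnique_solution` plus `W` analytic on
  `{‖Y‖ < a₃}`, the unique solution `X(𝔄)` in the ball (115) is `AnalyticOnNhd ℂ` on the OPEN parameter ball `‖𝔄‖ < a` (proof: at
  `𝔄₀` shrink the parameter radius to `a′ = (‖𝔄₀‖ + a)∕2` and spend the slack as ROOM `r′ = ε₄ + (a − a′)` for the unknown, so that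
  (119)–(120) (`lipschitz_120`) give the SAME contraction constant `θ + 4B₀C₄(ε₄ + a)` on the open ball `‖X‖ < r′`; glue by uniqueness);
  `solution_zero` — at `J = 0` the solution vanishes at `𝔄 = 0` (`W 0 = 0`).
* §2 **`chart174_differentiableOn`** — the (174) composite `B ↦ T(X(H₁B) + H₁B)` is Fréchet-holomorphic on any ball `‖B‖ < R` with
  `‖H₁B‖ < a` there, for `T` holomorphic on `‖·‖ < ε₄ + a`; **`chart174_triple`** — (Ψ1)–(Ψ3) LITERALLY in `NE9CurveFromBackgroundMap`'s
  shapes: `DifferentiableOn ℂ Ψ (ball 0 R)`, `MapsTo Ψ (ball 0 R) (ball 0 R′)` for any `R′ > 0` with `K(ε₄ + a) ≤ R′` (`T` `K`-Lipschitz on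
  the ball, `T 0 = 0` — the norm form of «𝓗 satisfies (19)–(21)»), `Ψ 0 = 0`; **`exists_backgroundMap_of_scheme`** — the two assembled:
  from the scheme's data and conditions ALONE, a background map with (Ψ1)–(Ψ3) which IS the (174) chart of the unique (175) solution.
* §2′ **`exists_chart47_of_scheme`** — the Sect. C Landau-gauge map (47) `A = A′ − HD(A′)`, `D` the fixed point of (50), is THE SAME
  scheme in the unknown `X′ = −HD` (`X′ = −H(C(X′ + A′)) = mapT H 0 C 0 A′ X′`), so §1 gives `T = (47)` as a Lean function ANALYTIC on
  a ball, `T 0 = 0`, with the (55)-type second-order bound and a Lipschitz bound (tree `T4FixedPointResponse.norm_solution_le_defect` ∕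
  `norm_solution_sub_le_data`); **`exists_backgroundMap_of_twoSchemes`** — R2′ FULLY ASSEMBLED: (174) ∘ (175) ∘ (47) ∘ (50) from the two
  schemes' letters and smallness conditions alone ⇒ a background map with (Ψ1)–(Ψ3).
* §3 `analyticOnNhd_of_prop4Hyp` — on FINITE-dimensional `𝒴` the extra analyticity hypothesis is `B11Prop6Scheme.Prop4Hyp` (Osgood).
WHAT THIS DOES NOT DO: type 𝔊, (δ/δA′)V, H₁, H, C on lattice carriers (route step B2′ = socket C19′, lit-balaban; FROZEN under ruling
e34b3e0c (0)); identify exp iη𝓗(B) with the minimiser U_k(V′V₀)U_k(V₀)⁻¹ (Prop. 9 — a READING); touch (D2) or N2.  DISGUISE TEST: Banach's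
fixed point with analytic parameter + composition; no inequality of the series is proved or used as a fact; not NE9; 0 def, 0 sorry.
References (TYPES ∕ loci only): [Balaban1985Variational] T. Bałaban, CMP **102** (1985) 277–309, (44)–(55) pp. 285–286, Prop. 3 p. 289,
(116)–(121) p. 295, Prop. 6 pp. 295–296, (172)–(175) p. 305, p. 306, Prop. 9 p. 309; [Balaban1987RG1] T. Bałaban, CMP **109** (1987), (3.27)
p. 275, (3.37) p. 277, Lemma 4 (3.53) p. 280.  Imports `NE9AnalyticFixedPoint`, `T4FixedPointResponse` (→ `B11Prop6Scheme`),
`Literature.Analysis.Complex.OsgoodProofs` ONLY; modifies nothing; no END re-wired.  Value = route-R2′ instantiation step, NOT summit progress.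
-/

noncomputable section

open scoped Topology NNReal
open Metric Set Filter

namespace Summit.QuantumFields.BalabanUV.T4Continuum.NE9B11SolutionAnalytic

open Literature.MathematicalPhysics.QuantumFieldTheory.Balaban1983to89
open Literature.MathematicalPhysics.QuantumFieldTheory.Balaban1983to89.B13Contraction113 (QuadAnalytic)
open Literature.MathematicalPhysics.QuantumFieldTheory.Balaban1983to89.B11Prop6Scheme
open Summit.QuantumFields.BalabanUV.T4Continuum.NE9AnalyticFixedPoint

variable {𝒴 𝒵 : Type*} [NormedAddCommGroup 𝒴] [NormedSpace ℂ 𝒴] [NormedAddCommGroup 𝒵] [NormedSpace ℂ 𝒵]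
variable {𝒢 : 𝒵 →L[ℂ] 𝒴} {Λ : 𝒴 →L[ℂ] 𝒴} {W : 𝒴 → 𝒵} {B₀ θ C₄ a₃ : ℝ}

/-! ## §1 The solution of (116)/(175) is analytic in the Banach datum `𝔄` -/

/-- [folklore] **Joint analyticity of the transformation.**  If `W` is analytic on the ball `{‖Y‖ < a₃}`, then
`(𝔄, X) ↦ mapT 𝒢 Λ W J 𝔄 X = −𝒢J + Λ(X + 𝔄) − 𝒢(W(X + 𝔄))` is analytic at every point of a set on which `‖X + 𝔄‖ < a₃`
(continuous linear maps and a composition).  The printed sentence it serves: [15] p. 296 *«The analyticity of these approximations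
follows from the analyticity of δ/δA′V(A′) as a function of A′»*. -/
theorem analyticOnNhd_mapT (hWa : AnalyticOnNhd ℂ W {Y : 𝒴 | ‖Y‖ < a₃}) (J : 𝒵) {s : Set (𝒴 × 𝒴)}
    (hs : ∀ q ∈ s, ‖q.2 + q.1‖ < a₃) :
    AnalyticOnNhd ℂ (fun q : 𝒴 × 𝒴 => mapT 𝒢 Λ W J q.1 q.2) s := by
  intro q hq
  have hlin : AnalyticAt ℂ (fun q : 𝒴 × 𝒴 => q.2 + q.1) q := analyticAt_snd.add analyticAt_fst
  have hW : AnalyticAt ℂ (fun q : 𝒴 × 𝒴 => W (q.2 + q.1)) q :=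
    AnalyticAt.comp (f := fun q : 𝒴 × 𝒴 => q.2 + q.1) (x := q) (hWa _ (hs q hq)) hlin
  have h1 : AnalyticAt ℂ (fun q : 𝒴 × 𝒴 => 𝒢 (W (q.2 + q.1))) q :=
    AnalyticAt.comp (f := fun q : 𝒴 × 𝒴 => W (q.2 + q.1)) (x := q) (𝒢.analyticAt _) hW
  have h2 : AnalyticAt ℂ (fun q : 𝒴 × 𝒴 => Λ (q.2 + q.1)) q :=
    AnalyticAt.comp (f := fun q : 𝒴 × 𝒴 => q.2 + q.1) (x := q) (Λ.analyticAt _) hlin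
  have h3 : AnalyticAt ℂ (fun _ : 𝒴 × 𝒴 => -𝒢 J) q := analyticAt_const
  show AnalyticAt ℂ (fun q : 𝒴 × 𝒴 => -𝒢 J + Λ (q.2 + q.1) - 𝒢 (W (q.2 + q.1))) q
  exact (h3.add h2).sub h1

/-- [folklore] `W 0 = 0` for a quadratic-analytic `W` on a ball of positive radius ((98): `‖W Y‖ ≤ C₄‖Y‖²`). -/
theorem map_zero_of_quadAnalytic (hW : QuadAnalytic W C₄ a₃) (ha₃ : 0 < a₃) : W 0 = 0 := by
  have h := hW.quad 0 (by rw [norm_zero]; exact ha₃)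
  rw [norm_zero] at h
  exact norm_le_zero_iff.1 (h.trans (by simp))

/-- [folklore] At `J = 0`, `𝔄 = 0`: `0` is a fixed point of the transformation as soon as `W 0 = 0`. -/
theorem mapT_zero_zero (hW0 : W 0 = 0) : mapT 𝒢 Λ W 0 (0 : 𝒴) 0 = 0 := by
  simp [mapT, hW0]

/-- (175)∕(158) as an equation: `X` is a fixed point of `mapT 𝒢 0 W 0 𝔄` iff `X + 𝒢(W(X + 𝔄)) = 0` — [15] p. 305 *«𝒜₁ + 𝔊((δ/δA′)V)(𝒜₁ +
H₁B) = 0, (175)»*. [cite: Balaban1985Variational, (175) p.305] -/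
theorem fixed_iff_175 {𝔄 : 𝒴} (X : 𝒴) : mapT 𝒢 0 W 0 𝔄 X = X ↔ X + 𝒢 (W (X + 𝔄)) = 0 := by
  rw [mapT_158, eq_comm, eq_neg_iff_add_eq_zero]

/-- **THE SOLUTION OF (116)/(175) IS FRÉCHET-ANALYTIC IN THE BANACH DATUM** (the Banach-parameter form of [15] Prop. 6 p. 296 *«the solution
is an analytic function of 𝔄»* and p. 306 *«𝒜₁, as a solution of Eq. (175), is an analytic function of H₁B, hence of B»*; mechanism
[folklore]: `NE9AnalyticFixedPoint.exists_analyticOnNhd_fixedPt_section`).  Hypotheses: EXACTLY those of `B11Prop6Scheme.existsUnique_solution`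
(`‖𝒢f‖ ≤ B₀‖f‖`, `‖ΛY‖ ≤ θ‖Y‖`, `QuadAnalytic W C₄ a₃`, `‖J‖ ≤ j`, `0 ≤ ε₄`, `2(ε₄ + a) ≤ a₃`, the self-map condition (118) and the
contraction condition (121), θ-extended) PLUS `W` analytic on `{‖Y‖ < a₃}` (on finite-dimensional `𝒴`: `Prop4Hyp`, §3).  Conclusion: ONE
function `Xs : 𝒴 → 𝒴`, `AnalyticOnNhd ℂ Xs (ball 0 a)`, which at every `‖𝔄‖ < a` is THE solution in the ball `‖X‖ ≤ ε₄` (lies there,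
solves, and every solution there equals it).  Proof: at `𝔄₀` take `a′ := (‖𝔄₀‖ + a)∕2`, room `r′ := ε₄ + (a − a′) > ε₄`; on
`ball 0 a′ × ball 0 r′` one has `‖X + 𝔄‖ < ε₄ + a`, so (118) gives the self-map of `closedBall 0 ε₄`, (119)–(120) at `(a′, r′)` give the
contraction constant `θ + 4B₀C₄(ε₄ + a) < 1` on the OPEN ball, and the map is jointly analytic there; the local analytic section agrees with
the pointwise unique solution on `ball 0 a′`. [cite: Balaban1985Variational, Prop. 6 pp.295-296 and (175) p.305, p.306] -/
theorem exists_analyticOnNhd_solution [CompleteSpace 𝒴] (h𝒢 : ∀ f, ‖𝒢 f‖ ≤ B₀ * ‖f‖) (hΛ : ∀ Y, ‖Λ Y‖ ≤ θ * ‖Y‖)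
    (hW : QuadAnalytic W C₄ a₃) (hWa : AnalyticOnNhd ℂ W {Y : 𝒴 | ‖Y‖ < a₃})
    (hB₀ : 0 ≤ B₀) (hC₄ : 0 ≤ C₄) (hθ : 0 ≤ θ) {J : 𝒵} {j : ℝ} (hJ : ‖J‖ ≤ j)
    {a ε₄ : ℝ} (hε₄ : 0 ≤ ε₄) (hdom : 2 * (ε₄ + a) ≤ a₃)
    (hself : B₀ * j + θ * (ε₄ + a) + B₀ * C₄ * (ε₄ + a) ^ 2 ≤ ε₄)
    (hcontr : θ + 4 * B₀ * C₄ * (ε₄ + a) < 1) :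
    ∃ Xs : 𝒴 → 𝒴, AnalyticOnNhd ℂ Xs (ball (0 : 𝒴) a) ∧
      ∀ 𝔄 ∈ ball (0 : 𝒴) a, ‖Xs 𝔄‖ ≤ ε₄ ∧ mapT 𝒢 Λ W J 𝔄 (Xs 𝔄) = Xs 𝔄 ∧
        ∀ X' : 𝒴, ‖X'‖ ≤ ε₄ → mapT 𝒢 Λ W J 𝔄 X' = X' → X' = Xs 𝔄 := by
  classical
  -- the pointwise unique solution (Prop. 6, `existsUnique_solution`)
  have hsol : ∀ 𝔄 ∈ ball (0 : 𝒴) a, ∃! X : 𝒴, ‖X‖ ≤ ε₄ ∧ mapT 𝒢 Λ W J 𝔄 X = X := fun 𝔄 h𝔄 =>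
    existsUnique_solution h𝒢 hΛ hW hB₀ hC₄ hθ hJ (mem_ball_zero_iff.1 h𝔄) hε₄ hdom hself hcontr
  let Xs : 𝒴 → 𝒴 := fun 𝔄 => if h : 𝔄 ∈ ball (0 : 𝒴) a then (hsol 𝔄 h).exists.choose else 0
  have hXs : ∀ 𝔄 (h : 𝔄 ∈ ball (0 : 𝒴) a), ‖Xs 𝔄‖ ≤ ε₄ ∧ mapT 𝒢 Λ W J 𝔄 (Xs 𝔄) = Xs 𝔄 := by
    intro 𝔄 h
    simp only [Xs, dif_pos h]
    exact (hsol 𝔄 h).exists.choose_spec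
  have huniq : ∀ 𝔄 (h : 𝔄 ∈ ball (0 : 𝒴) a), ∀ X' : 𝒴, ‖X'‖ ≤ ε₄ → mapT 𝒢 Λ W J 𝔄 X' = X' → X' = Xs 𝔄 :=
    fun 𝔄 h X' hX' hfix => (hsol 𝔄 h).unique ⟨hX', hfix⟩ (hXs 𝔄 h)
  refine ⟨Xs, fun 𝔄₀ h𝔄₀ => ?_, fun 𝔄 h => ⟨(hXs 𝔄 h).1, (hXs 𝔄 h).2, huniq 𝔄 h⟩⟩
  -- analyticity at `𝔄₀`: a local analytic section on a smaller parameter ball, with room for the unknown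
  have hn₀ : ‖𝔄₀‖ < a := mem_ball_zero_iff.1 h𝔄₀
  set a' : ℝ := (‖𝔄₀‖ + a) / 2 with ha'
  have ha'lt : a' < a := by rw [ha']; linarith
  have h𝔄₀a' : ‖𝔄₀‖ < a' := by rw [ha']; linarith
  have hapos : 0 < a := lt_of_le_of_lt (norm_nonneg _) hn₀
  set r' : ℝ := ε₄ + (a - a') with hr'
  have hrr' : ε₄ < r' := by rw [hr']; linarith
  have hsum : r' + a' = ε₄ + a := by rw [hr']; ring
  have hεa : 0 < ε₄ + a := by linarith
  have hκ0 : 0 ≤ θ + 4 * B₀ * C₄ * (ε₄ + a) :=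
    add_nonneg hθ (mul_nonneg (mul_nonneg (mul_nonneg (by norm_num) hB₀) hC₄) hεa.le)
  let K : ℝ≥0 := ⟨θ + 4 * B₀ * C₄ * (ε₄ + a), hκ0⟩
  have hK : (K : ℝ) < 1 := hcontr
  have hmaps : ∀ 𝔄 ∈ ball (0 : 𝒴) a', MapsTo (mapT 𝒢 Λ W J 𝔄) (closedBall 0 ε₄) (closedBall 0 ε₄) := by
    intro 𝔄 h𝔄 X hX
    rw [mem_closedBall_zero_iff] at hX ⊢
    have h𝔄a : ‖𝔄‖ < a := (mem_ball_zero_iff.1 h𝔄).trans ha'lt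
    exact mapsTo_118 h𝒢 hΛ hW hB₀ hC₄ hθ hJ h𝔄a (by linarith) hself X hX
  have hlip : ∀ 𝔄 ∈ ball (0 : 𝒴) a', LipschitzOnWith K (mapT 𝒢 Λ W J 𝔄) (ball 0 r') := by
    intro 𝔄 h𝔄
    refine LipschitzOnWith.of_dist_le_mul fun X hX X' hX' => ?_
    rw [dist_eq_norm, dist_eq_norm]
    have h := lipschitz_120 (J := J) (a := a') (ε₄ := r') h𝒢 hΛ hW hB₀ hC₄ (mem_ball_zero_iff.1 h𝔄)
      (by linarith) (by rw [hsum]; exact hdom) (le_of_lt (mem_ball_zero_iff.1 hX)) (le_of_lt (mem_ball_zero_iff.1 hX'))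
    rwa [hsum] at h
  have hT : AnalyticOnNhd ℂ (fun q : 𝒴 × 𝒴 => mapT 𝒢 Λ W J q.1 q.2) (ball (0 : 𝒴) a' ×ˢ ball (0 : 𝒴) r') := by
    refine analyticOnNhd_mapT hWa J fun q hq => ?_
    obtain ⟨h1, h2⟩ := mem_prod.1 hq
    rw [mem_ball_zero_iff] at h1 h2
    calc ‖q.2 + q.1‖ ≤ ‖q.2‖ + ‖q.1‖ := norm_add_le _ _
      _ < r' + a' := add_lt_add h2 h1
      _ = ε₄ + a := hsum
      _ < a₃ := by linarith
  obtain ⟨x, hxa, -, hxuniq, -⟩ :=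
    exists_analyticOnNhd_fixedPt_section (fun 𝔄 X => mapT 𝒢 Λ W J 𝔄 X) isOpen_ball hε₄ hrr' hK hmaps hlip hT
  have heq : ∀ 𝔄 ∈ ball (0 : 𝒴) a', Xs 𝔄 = x 𝔄 := fun 𝔄 h𝔄 =>
    hxuniq 𝔄 h𝔄 (Xs 𝔄) (mem_closedBall_zero_iff.2 (hXs 𝔄 (ball_subset_ball ha'lt.le h𝔄)).1) (hXs 𝔄 (ball_subset_ball ha'lt.le h𝔄)).2
  have hev : x =ᶠ[𝓝 𝔄₀] Xs := by
    filter_upwards [isOpen_ball.mem_nhds (mem_ball_zero_iff.2 h𝔄₀a')] with 𝔄 h𝔄 using (heq 𝔄 h𝔄).symm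
  exact (hxa 𝔄₀ (mem_ball_zero_iff.2 h𝔄₀a')).congr hev

/-- **At `J = 0` the solution vanishes at `𝔄 = 0`** ([15] Prop. 9's setting: `B = 0` gives `U_k(V₀)U_k(V₀)⁻¹ = 1`; here: `0` solves (175) at
`𝔄 = 0` because `W 0 = 0`, and the solution in the ball is unique).  For ANY function `Xs` which is the unique solution pointwise on the
ball (as delivered by `exists_analyticOnNhd_solution`). [cite: Balaban1985Variational, (175) p.305, Prop. 9 p.309] -/
theorem solution_zero (hW : QuadAnalytic W C₄ a₃) {a ε₄ : ℝ} (ha : 0 < a) (hε₄ : 0 ≤ ε₄) (hdom : 2 * (ε₄ + a) ≤ a₃)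
    {Xs : 𝒴 → 𝒴} (huniq : ∀ 𝔄 ∈ ball (0 : 𝒴) a, ∀ X' : 𝒴, ‖X'‖ ≤ ε₄ → mapT 𝒢 Λ W 0 𝔄 X' = X' → X' = Xs 𝔄) :
    Xs 0 = 0 := by
  have ha₃ : 0 < a₃ := by linarith
  exact (huniq 0 (mem_ball_self ha) 0 (by rw [norm_zero]; exact hε₄) (mapT_zero_zero (map_zero_of_quadAnalytic hW ha₃))).symm

/-! ## §2 The (174) composite is Fréchet-holomorphic in `B` and meets (Ψ1)–(Ψ3) -/

/-- **THE CHART (174) IS FRÉCHET-HOLOMORPHIC IN `B`** ([15] p. 309 Prop. 9 *«The function 𝓗(B) is determined by Eqs. (174), (175) … It is an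
analytic function of B»*; p. 305 *«The function on the right-hand side of (174) is an analytic function of 𝒜₁ + H₁B»*).  For `Xs` analytic on
`ball 0 a` and valued in `‖X‖ ≤ ε₄` there (§1), `H₁ : 𝒳 →L[ℂ] 𝒴` (the linear minimiser (103), a DATUM), `T : 𝒴 → 𝒴` holomorphic on
`‖·‖ < ε₄ + a` (the Sect. C map (47) `A′ ↦ A′ − HD(A′)`, a DATUM), and a ball `‖B‖ < R` on which `‖H₁B‖ < a`:
`B ↦ T(Xs(H₁B) + H₁B)` is `DifferentiableOn ℂ` on `ball 0 R`. [cite: Balaban1985Variational, (174) p.305, Prop. 9 p.309] -/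
theorem chart174_differentiableOn {a ε₄ : ℝ} {Xs : 𝒴 → 𝒴} (hXa : AnalyticOnNhd ℂ Xs (ball (0 : 𝒴) a))
    (hXb : ∀ 𝔄 ∈ ball (0 : 𝒴) a, ‖Xs 𝔄‖ ≤ ε₄) {𝒳 : Type*} [NormedAddCommGroup 𝒳] [NormedSpace ℂ 𝒳]
    (H₁ : 𝒳 →L[ℂ] 𝒴) {R : ℝ} (hR : ∀ B ∈ ball (0 : 𝒳) R, ‖H₁ B‖ < a) {T : 𝒴 → 𝒴}
    (hTd : DifferentiableOn ℂ T (ball (0 : 𝒴) (ε₄ + a))) :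
    DifferentiableOn ℂ (fun B => T (Xs (H₁ B) + H₁ B)) (ball (0 : 𝒳) R) := by
  have hH : DifferentiableOn ℂ (fun B : 𝒳 => H₁ B) (ball (0 : 𝒳) R) := H₁.differentiable.differentiableOn
  have hHm : MapsTo (fun B : 𝒳 => H₁ B) (ball (0 : 𝒳) R) (ball (0 : 𝒴) a) := fun B hB => mem_ball_zero_iff.2 (hR B hB)
  have hX : DifferentiableOn ℂ (fun B : 𝒳 => Xs (H₁ B)) (ball (0 : 𝒳) R) := hXa.differentiableOn.comp hH hHm
  refine hTd.comp (hX.add hH) fun B hB => ?_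
  rw [mem_ball_zero_iff]
  exact norm_arg_lt (hR B hB) (hXb _ (hHm hB))

/-- **(Ψ1)–(Ψ3) FOR THE (174) CHART, LITERALLY IN `NE9CurveFromBackgroundMap`'s SHAPES.**  With the data of `chart174_differentiableOn`, `Xs 0 = 0`
(§1 `solution_zero`), `T 0 = 0` and `T` `K`-Lipschitz on `‖·‖ < ε₄ + a` (`0 ≤ K`; the norm form of [15] (173)∕Prop. 9 *«𝓗 satisfies the
conditions (19)–(21) with ε₂ = B₅ε₁»* and of [I] (3.27)), and any chart radius `R′ > 0` with `K(ε₄ + a) ≤ R′`: the map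
`Ψ B := T(Xs(H₁B) + H₁B)` satisfies (Ψ1) `DifferentiableOn ℂ Ψ (ball 0 R)`, (Ψ2) `MapsTo Ψ (ball 0 R) (ball 0 R′)`, (Ψ3) `Ψ 0 = 0` — the
three background-map binders of `NE9CurveFromBackgroundMap.admissible_compCur` ∕ `cpieceResponse_compCur` ((Ψ1) [I] (3.37) p. 277, (Ψ2) [I]
Lemma 4 (3.53) p. 280 — TYPES). [cite: Balaban1985Variational, (173)-(175) p.305, Prop. 9 p.309; Balaban1987RG1, (3.37) p.277, (3.53) p.280] -/
theorem chart174_triple {a ε₄ : ℝ} (hε₄ : 0 ≤ ε₄) {Xs : 𝒴 → 𝒴} (hXa : AnalyticOnNhd ℂ Xs (ball (0 : 𝒴) a))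
    (hXb : ∀ 𝔄 ∈ ball (0 : 𝒴) a, ‖Xs 𝔄‖ ≤ ε₄) (hX0 : Xs 0 = 0) {𝒳 : Type*} [NormedAddCommGroup 𝒳] [NormedSpace ℂ 𝒳]
    (H₁ : 𝒳 →L[ℂ] 𝒴) {R : ℝ} (hR : ∀ B ∈ ball (0 : 𝒳) R, ‖H₁ B‖ < a) {T : 𝒴 → 𝒴}
    (hTd : DifferentiableOn ℂ T (ball (0 : 𝒴) (ε₄ + a))) (hT0 : T 0 = 0) {K : ℝ} (hK : 0 ≤ K)
    (hT : ∀ x y : 𝒴, ‖x‖ < ε₄ + a → ‖y‖ < ε₄ + a → ‖T x - T y‖ ≤ K * ‖x - y‖)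
    {R' : ℝ} (hR'0 : 0 < R') (hR' : K * (ε₄ + a) ≤ R') :
    DifferentiableOn ℂ (fun B => T (Xs (H₁ B) + H₁ B)) (ball (0 : 𝒳) R) ∧
      MapsTo (fun B => T (Xs (H₁ B) + H₁ B)) (ball (0 : 𝒳) R) (ball (0 : 𝒴) R') ∧
      T (Xs (H₁ 0) + H₁ 0) = 0 := by
  refine ⟨chart174_differentiableOn hXa hXb H₁ hR hTd, fun B hB => ?_, by rw [map_zero, hX0, add_zero, hT0]⟩
  have hHa : ‖H₁ B‖ < a := hR B hB
  have hXε : ‖Xs (H₁ B)‖ ≤ ε₄ := hXb _ (mem_ball_zero_iff.2 hHa)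
  have harg : ‖Xs (H₁ B) + H₁ B‖ < ε₄ + a := norm_arg_lt hHa hXε
  have h0 : ‖(0 : 𝒴)‖ < ε₄ + a := by rw [norm_zero]; linarith [norm_nonneg (H₁ B)]
  have h1 : ‖T (Xs (H₁ B) + H₁ B)‖ ≤ K * ‖Xs (H₁ B) + H₁ B‖ := by
    have := hT _ _ harg h0
    rwa [hT0, sub_zero, sub_zero] at this
  rw [mem_ball_zero_iff]
  rcases hK.eq_or_lt with hK0 | hKpos
  · rw [← hK0, zero_mul] at h1
    exact lt_of_le_of_lt h1 hR'0
  · exact lt_of_le_of_lt h1 ((mul_lt_mul_of_pos_left harg hKpos).trans_le hR')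

/-- **ROUTE R2′ ASSEMBLED AT SCHEME LEVEL: FROM THE CONTRACTION SCHEME'S DATA AND CONDITIONS ALONE, A BACKGROUND MAP WITH (Ψ1)–(Ψ3) WHICH IS
THE (174) CHART OF THE UNIQUE (175) SOLUTION.**  Data: `𝒢 = 𝔊` with `‖𝒢f‖ ≤ B₀‖f‖` ([15] (46)∕(117) «By Theorem 3.13 of [5]»), `Λ` with
`‖ΛY‖ ≤ θ‖Y‖` (`Λ = 0` for (175); `G̃Δ^{(2)}` for (180)), `W = (δ/δA′)V` quadratic-analytic AND analytic on `{‖Y‖ < a₃}` (Prop. 4 (97)–(98);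
on finite-dimensional `𝒴` the second is `Prop4Hyp`, §3), `H₁` with `‖H₁B‖ < a` on `‖B‖ < R` ((103) with (172) «|B′| < 2C₁ε₁»), `T` = (47)
holomorphic and `K`-Lipschitz on `‖·‖ < ε₄ + a` with `T 0 = 0` (Prop. 3); conditions `0 ≤ ε₄`, `0 < a`, `2(ε₄ + a) ≤ a₃`, (118):
`θ(ε₄ + a) + B₀C₄(ε₄ + a)² ≤ ε₄` (J = 0), (121): `θ + 4B₀C₄(ε₄ + a) < 1`, and a chart radius `R′ > 0`, `K(ε₄ + a) ≤ R′`.  Conclusion: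
there is `Xs : 𝒴 → 𝒴`, analytic on `ball 0 a`, which at each `‖𝔄‖ < a` is THE solution of `X = Λ(X + 𝔄) − 𝒢(W(X + 𝔄))` in `‖X‖ ≤ ε₄`
(for `Λ = 0`: of (175) `𝒜₁ + 𝔊((δ/δA′)V)(𝒜₁ + 𝔄) = 0`), `Xs 0 = 0`, and `Ψ B := T(Xs(H₁B) + H₁B)` — (174) — satisfies (Ψ1)–(Ψ3) on
`ball 0 R → ball 0 R′`.  What then remains for species (a)'s `cur` on route R2′ is B2′ ONLY: inhabit these letters on lattice carriers
(socket C19′) and read `Ψ` in the END's chart space. [cite: Balaban1985Variational, Prop. 6 pp.295-296, (172)-(175) p.305, Prop. 9 p.309; Balaban1987RG1, (3.37) p.277, (3.53) p.280] -/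
theorem exists_backgroundMap_of_scheme [CompleteSpace 𝒴] (h𝒢 : ∀ f, ‖𝒢 f‖ ≤ B₀ * ‖f‖) (hΛ : ∀ Y, ‖Λ Y‖ ≤ θ * ‖Y‖)
    (hW : QuadAnalytic W C₄ a₃) (hWa : AnalyticOnNhd ℂ W {Y : 𝒴 | ‖Y‖ < a₃})
    (hB₀ : 0 ≤ B₀) (hC₄ : 0 ≤ C₄) (hθ : 0 ≤ θ) {a ε₄ : ℝ} (ha : 0 < a) (hε₄ : 0 ≤ ε₄) (hdom : 2 * (ε₄ + a) ≤ a₃)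
    (hself : θ * (ε₄ + a) + B₀ * C₄ * (ε₄ + a) ^ 2 ≤ ε₄) (hcontr : θ + 4 * B₀ * C₄ * (ε₄ + a) < 1)
    {𝒳 : Type*} [NormedAddCommGroup 𝒳] [NormedSpace ℂ 𝒳] (H₁ : 𝒳 →L[ℂ] 𝒴) {R : ℝ} (hR : ∀ B ∈ ball (0 : 𝒳) R, ‖H₁ B‖ < a)
    {T : 𝒴 → 𝒴} (hTd : DifferentiableOn ℂ T (ball (0 : 𝒴) (ε₄ + a))) (hT0 : T 0 = 0) {K : ℝ} (hK : 0 ≤ K)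
    (hT : ∀ x y : 𝒴, ‖x‖ < ε₄ + a → ‖y‖ < ε₄ + a → ‖T x - T y‖ ≤ K * ‖x - y‖)
    {R' : ℝ} (hR'0 : 0 < R') (hR' : K * (ε₄ + a) ≤ R') :
    ∃ Xs : 𝒴 → 𝒴, AnalyticOnNhd ℂ Xs (ball (0 : 𝒴) a) ∧
      (∀ 𝔄 ∈ ball (0 : 𝒴) a, ‖Xs 𝔄‖ ≤ ε₄ ∧ mapT 𝒢 Λ W 0 𝔄 (Xs 𝔄) = Xs 𝔄 ∧
        ∀ X' : 𝒴, ‖X'‖ ≤ ε₄ → mapT 𝒢 Λ W 0 𝔄 X' = X' → X' = Xs 𝔄) ∧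
      Xs 0 = 0 ∧
      DifferentiableOn ℂ (fun B => T (Xs (H₁ B) + H₁ B)) (ball (0 : 𝒳) R) ∧
      MapsTo (fun B => T (Xs (H₁ B) + H₁ B)) (ball (0 : 𝒳) R) (ball (0 : 𝒴) R') ∧
      T (Xs (H₁ 0) + H₁ 0) = 0 := by
  have hJ : ‖(0 : 𝒵)‖ ≤ 0 := by rw [norm_zero]
  have hself' : B₀ * 0 + θ * (ε₄ + a) + B₀ * C₄ * (ε₄ + a) ^ 2 ≤ ε₄ := by rw [mul_zero, zero_add]; exact hself
  obtain ⟨Xs, hXa, hXs⟩ := exists_analyticOnNhd_solution h𝒢 hΛ hW hWa hB₀ hC₄ hθ hJ hε₄ hdom hself' hcontr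
  have hXb : ∀ 𝔄 ∈ ball (0 : 𝒴) a, ‖Xs 𝔄‖ ≤ ε₄ := fun 𝔄 h => (hXs 𝔄 h).1
  have hX0 : Xs 0 = 0 := solution_zero hW ha hε₄ hdom fun 𝔄 h => (hXs 𝔄 h).2.2
  exact ⟨Xs, hXa, hXs, hX0, chart174_triple hε₄ hXa hXb hX0 H₁ hR hTd hT0 hK hT hR'0 hR'⟩

/-! ## §2′ The Sect. C map (47) `A′ ↦ A′ − HD(A′)` from ITS contraction, by the same theorem -/

omit [NormedSpace ℂ 𝒵] in
/-- [folklore] `‖(x − y) + u‖ ≤ ‖x − y‖ + q‖x − y‖∕(1 − q) = ‖x − y‖∕(1 − q)` bookkeeping: if `‖u‖ ≤ (0 + q·d)∕(1 − q)` then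
`d + ‖u‖ ≤ d∕(1 − q)` (`q < 1`, `0 ≤ d`). -/
theorem add_le_div_one_sub {q d u : ℝ} (hq : q < 1) (hu : u ≤ (0 + q * d) / (1 - q)) :
    d + u ≤ 1 / (1 - q) * d := by
  have h1q : (1 : ℝ) - q ≠ 0 := by linarith
  have e : 1 / (1 - q) * d = d + q * d / (1 - q) := by field_simp; ring
  rw [zero_add] at hu; rw [e]; linarith

/-- **THE LANDAU-GAUGE MAP (47) OF [15] Sect. C, `A = A′ − HD(A′)`, WITH `D(A′)` THE FIXED POINT OF (50), IS ITSELF AN INSTANCE OF §1.**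
Print (pp. 285–287): *«A = A′ − HD(A′), (47)»* chosen so that *«Q_j(ηA) = L^jηQ_jA′ on Λ_j (48)»*; `D(A′)` solves the fixed-point equation
`D = C(A′ − HD)` with *«|C_j(X)| ≤ C₂|X|²»* ([4] Prop. 4, complex form Prop. 7), contraction by the Cauchy formula (54), *«there exists
exactly one fixed point … it is an analytic function of A′»*, *«|D(A′)| ≤ 4C₂|A′|²_{(−1)} (55)»*; Prop. 3 p. 289: *«The transformation (47)
… is defined and analytic for A′ satisfying (43) with ε₃ sufficiently small»*.  SCHEME FORM: in the unknown `X′ := −HD ∈ 𝒴` the equation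
reads `X′ = −H(C(X′ + A′)) = mapT H 0 C 0 A′ X′` — the transformation of `B11Prop6Scheme` with `(𝒢, W, Λ, J) := (H, C, 0, 0)` — so §1
applies verbatim: with `‖Hf‖ ≤ B₀‖f‖` ((46) «Theorem 3.12 from [5]»), `C` quadratic-analytic with constants `(C₂, c₄)` and analytic on
`{‖Y‖ < c₄}`, and the conditions `2(ε_C + a_C) ≤ c₄`, `B₀C₂(ε_C + a_C)² ≤ ε_C`, `4B₀C₂(ε_C + a_C) < 1` (scheme letters; print organises
the same smallness as «18C₂B₀ε₃ ≤ 1»), there is `T : 𝒴 → 𝒴` — (47) — with: `T A′ − A′` THE solution `X′(A′)` in `‖X′‖ ≤ ε_C` for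
`‖A′‖ < a_C` (so `HD(A′) = −(T A′ − A′)` and `D(A′) = C(T A′)`: `T A′ − A′ = −H(C(T A′))`), `T` ANALYTIC on `ball 0 a_C`, `T 0 = 0`, the
(55)-type second-order bound `‖T A′ − A′‖ ≤ B₀C₂‖A′‖²∕(1 − q_C)` (`T4FixedPointResponse.norm_solution_le_defect`), and the Lipschitz bound
`‖T x − T y‖ ≤ ‖x − y‖∕(1 − q_C)` on the ball (`T4FixedPointResponse.norm_solution_sub_le_data`), `q_C := 4B₀C₂(ε_C + a_C)`.
[cite: Balaban1985Variational, (47)-(48) p.285, (54)-(55) p.286, Prop. 3 p.289] -/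
theorem exists_chart47_of_scheme [CompleteSpace 𝒴] {𝒳 : Type*} [NormedAddCommGroup 𝒳] [NormedSpace ℂ 𝒳]
    {H : 𝒳 →L[ℂ] 𝒴} {C : 𝒴 → 𝒳} {b C₂ c₄ : ℝ}
    (hH : ∀ f, ‖H f‖ ≤ b * ‖f‖) (hC : QuadAnalytic C C₂ c₄) (hCa : AnalyticOnNhd ℂ C {Y : 𝒴 | ‖Y‖ < c₄})
    (hb : 0 ≤ b) (hC₂ : 0 ≤ C₂) {aC εC : ℝ} (haC : 0 < aC) (hεC : 0 ≤ εC) (hdom : 2 * (εC + aC) ≤ c₄)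
    (hself : b * C₂ * (εC + aC) ^ 2 ≤ εC) (hcontr : 4 * b * C₂ * (εC + aC) < 1) :
    ∃ T : 𝒴 → 𝒴,
      (∀ A' ∈ ball (0 : 𝒴) aC, ‖T A' - A'‖ ≤ εC ∧ T A' - A' = -H (C (T A')) ∧
        ∀ X' : 𝒴, ‖X'‖ ≤ εC → X' = -H (C (X' + A')) → X' = T A' - A') ∧
      AnalyticOnNhd ℂ T (ball (0 : 𝒴) aC) ∧ T 0 = 0 ∧
      (∀ A' ∈ ball (0 : 𝒴) aC, ‖T A' - A'‖ ≤ b * C₂ * ‖A'‖ ^ 2 / (1 - 4 * b * C₂ * (εC + aC))) ∧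
      (∀ x y : 𝒴, ‖x‖ < aC → ‖y‖ < aC → ‖T x - T y‖ ≤ 1 / (1 - 4 * b * C₂ * (εC + aC)) * ‖x - y‖) := by
  have hΛ : ∀ Y : 𝒴, ‖(0 : 𝒴 →L[ℂ] 𝒴) Y‖ ≤ 0 * ‖Y‖ := fun Y => by simp
  have hJ : ‖(0 : 𝒳)‖ ≤ 0 := by rw [norm_zero]
  have hself' : b * 0 + 0 * (εC + aC) + b * C₂ * (εC + aC) ^ 2 ≤ εC := by
    rw [mul_zero, zero_mul, zero_add, zero_add]; exact hself
  have hcontr' : 0 + 4 * b * C₂ * (εC + aC) < 1 := by rw [zero_add]; exact hcontr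
  obtain ⟨Xs, hXa, hXs⟩ := exists_analyticOnNhd_solution (𝒢 := H) (Λ := 0) (W := C) hH hΛ hC hCa hb hC₂ le_rfl hJ
    hεC hdom hself' hcontr'
  have hX0 : Xs 0 = 0 := solution_zero (𝒢 := H) (Λ := 0) hC haC hεC hdom fun 𝔄 h => (hXs 𝔄 h).2.2
  have hfixeq : ∀ (A' X : 𝒴), mapT H 0 C 0 A' X = -H (C (X + A')) := fun A' X => mapT_158 H C A' X
  refine ⟨fun A' => A' + Xs A', fun A' hA' => ?_, analyticOnNhd_id.add hXa, ?_, fun A' hA' => ?_, fun x y hx hy => ?_⟩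
  · obtain ⟨hn, hfix, huniq⟩ := hXs A' hA'
    beta_reduce
    refine ⟨by rwa [add_sub_cancel_left], ?_, fun X' hX' hX'eq => ?_⟩
    · rw [add_sub_cancel_left, add_comm A' (Xs A'), ← hfixeq]; exact hfix.symm
    · rw [add_sub_cancel_left]; exact huniq X' hX' (by rw [hfixeq]; exact hX'eq.symm)
  · beta_reduce; rw [hX0, add_zero]
  · obtain ⟨hn, hfix, -⟩ := hXs A' hA'
    have h := T4FixedPointResponse.norm_solution_le_defect (J := (0 : 𝒳)) hH hΛ hC hb hC₂ (mem_ball_zero_iff.1 hA') hεC hdom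
      hcontr' hn hfix
    beta_reduce
    rw [add_sub_cancel_left]
    simpa using h
  · obtain ⟨hnx, hfx, -⟩ := hXs x (mem_ball_zero_iff.2 hx)
    obtain ⟨hny, hfy, -⟩ := hXs y (mem_ball_zero_iff.2 hy)
    have h := T4FixedPointResponse.norm_solution_sub_le_data (J₁ := (0 : 𝒳)) (J₂ := (0 : 𝒳)) hH hΛ hC hb hC₂ hx hy hεC hdom
      hcontr' hnx hny hfx hfy
    have hsplit : x + Xs x - (y + Xs y) = (x - y) + (Xs x - Xs y) := by abel
    beta_reduce
    rw [hsplit]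
    refine (norm_add_le _ _).trans (add_le_div_one_sub hcontr ?_)
    simpa using h

/-- **ROUTE R2′ FULLY ASSEMBLED AT SCHEME LEVEL — (174) ∘ (175) ∘ (47) ∘ (50) FROM DISPLAYED-TYPE LETTERS ONLY.**  Two contraction schemes:
the Sect. E∕G one (`𝒢 = 𝔊`, `W = (δ/δA′)V`, constants `B₀, C₄, a₃`, ball `ε₄`, datum radius `a`; `Λ = 0`, `J = 0` as in (175)) and the
Sect. C one (`H`, `C`, constants `b, C₂, c₄`, ball `ε_C`, radius `a_C ≥ ε₄ + a` so that (47) is defined where `𝒜₁ + H₁B` lives), each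
with its three smallness conditions, `W` and `C` analytic on their balls (finite dimension: `Prop4Hyp`, §3), `H₁` with `‖H₁B‖ < a` on
`‖B‖ < R`, and a chart radius `R′ > 0` with `(ε₄ + a)∕(1 − q_C) ≤ R′`.  THEN the background map of Bałaban's shape
`Ψ B := T(𝒜₁(H₁B) + H₁B)` — `T` = (47) built from (50), `𝒜₁` = THE (175) solution — EXISTS as a Lean function with (Ψ1)
`DifferentiableOn ℂ Ψ (ball 0 R)`, (Ψ2) `MapsTo Ψ (ball 0 R) (ball 0 R′)`, (Ψ3) `Ψ 0 = 0`.  What route R2′ then still owes species (a) is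
B2′ ALONE: the letters `𝔊, (δ/δA′)V, H, C, H₁` on lattice carriers with their displayed bounds (socket C19′).
[cite: Balaban1985Variational, (47) p.285, (55) p.286, Prop. 6 pp.295-296, (172)-(175) p.305, Prop. 9 p.309; Balaban1987RG1, (3.37) p.277, (3.53) p.280] -/
theorem exists_backgroundMap_of_twoSchemes [CompleteSpace 𝒴] {𝒳 : Type*} [NormedAddCommGroup 𝒳] [NormedSpace ℂ 𝒳]
    -- the Sect. E/G scheme (175)
    (h𝒢 : ∀ f, ‖𝒢 f‖ ≤ B₀ * ‖f‖) (hW : QuadAnalytic W C₄ a₃) (hWa : AnalyticOnNhd ℂ W {Y : 𝒴 | ‖Y‖ < a₃})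
    (hB₀ : 0 ≤ B₀) (hC₄ : 0 ≤ C₄) {a ε₄ : ℝ} (ha : 0 < a) (hε₄ : 0 ≤ ε₄) (hdom : 2 * (ε₄ + a) ≤ a₃)
    (hself : B₀ * C₄ * (ε₄ + a) ^ 2 ≤ ε₄) (hcontr : 4 * B₀ * C₄ * (ε₄ + a) < 1)
    -- the Sect. C scheme (50)
    {H : 𝒳 →L[ℂ] 𝒴} {C : 𝒴 → 𝒳} {b C₂ c₄ : ℝ}
    (hH : ∀ f, ‖H f‖ ≤ b * ‖f‖) (hC : QuadAnalytic C C₂ c₄) (hCa : AnalyticOnNhd ℂ C {Y : 𝒴 | ‖Y‖ < c₄})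
    (hb : 0 ≤ b) (hC₂ : 0 ≤ C₂) {aC εC : ℝ} (haCge : ε₄ + a ≤ aC) (hεC : 0 ≤ εC) (hdomC : 2 * (εC + aC) ≤ c₄)
    (hselfC : b * C₂ * (εC + aC) ^ 2 ≤ εC) (hcontrC : 4 * b * C₂ * (εC + aC) < 1)
    -- the B-datum and the chart radius
    {ℬ : Type*} [NormedAddCommGroup ℬ] [NormedSpace ℂ ℬ] (H₁ : ℬ →L[ℂ] 𝒴) {R : ℝ} (hR : ∀ B ∈ ball (0 : ℬ) R, ‖H₁ B‖ < a)
    {R' : ℝ} (hR'0 : 0 < R') (hR' : 1 / (1 - 4 * b * C₂ * (εC + aC)) * (ε₄ + a) ≤ R') :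
    ∃ (T : 𝒴 → 𝒴) (Xs : 𝒴 → 𝒴),
      (∀ A' ∈ ball (0 : 𝒴) aC, ‖T A' - A'‖ ≤ εC ∧ T A' - A' = -H (C (T A')) ∧
        ∀ X' : 𝒴, ‖X'‖ ≤ εC → X' = -H (C (X' + A')) → X' = T A' - A') ∧
      (∀ 𝔄 ∈ ball (0 : 𝒴) a, ‖Xs 𝔄‖ ≤ ε₄ ∧ Xs 𝔄 + 𝒢 (W (Xs 𝔄 + 𝔄)) = 0 ∧
        ∀ X' : 𝒴, ‖X'‖ ≤ ε₄ → X' + 𝒢 (W (X' + 𝔄)) = 0 → X' = Xs 𝔄) ∧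
      AnalyticOnNhd ℂ Xs (ball (0 : 𝒴) a) ∧ Xs 0 = 0 ∧
      DifferentiableOn ℂ (fun B => T (Xs (H₁ B) + H₁ B)) (ball (0 : ℬ) R) ∧
      MapsTo (fun B => T (Xs (H₁ B) + H₁ B)) (ball (0 : ℬ) R) (ball (0 : 𝒴) R') ∧
      T (Xs (H₁ 0) + H₁ 0) = 0 := by
  have hεa : 0 < ε₄ + a := by linarith
  have haC : 0 < aC := lt_of_lt_of_le hεa haCge
  obtain ⟨T, hTsol, hTa, hT0, -, hTlip⟩ := exists_chart47_of_scheme hH hC hCa hb hC₂ haC hεC hdomC hselfC hcontrC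
  have hΛ : ∀ Y : 𝒴, ‖(0 : 𝒴 →L[ℂ] 𝒴) Y‖ ≤ 0 * ‖Y‖ := fun Y => by simp
  have hself' : 0 * (ε₄ + a) + B₀ * C₄ * (ε₄ + a) ^ 2 ≤ ε₄ := by rw [zero_mul, zero_add]; exact hself
  have hcontr' : 0 + 4 * B₀ * C₄ * (ε₄ + a) < 1 := by rw [zero_add]; exact hcontr
  have hq : 0 ≤ 1 / (1 - 4 * b * C₂ * (εC + aC)) := by
    have : 0 < 1 - 4 * b * C₂ * (εC + aC) := by linarith
    positivity
  have hTd : DifferentiableOn ℂ T (ball (0 : 𝒴) (ε₄ + a)) := hTa.differentiableOn.mono (ball_subset_ball haCge)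
  have hTlip' : ∀ x y : 𝒴, ‖x‖ < ε₄ + a → ‖y‖ < ε₄ + a → ‖T x - T y‖ ≤ 1 / (1 - 4 * b * C₂ * (εC + aC)) * ‖x - y‖ :=
    fun x y hx hy => hTlip x y (lt_of_lt_of_le hx haCge) (lt_of_lt_of_le hy haCge)
  obtain ⟨Xs, hXa, hXs, hX0, hΨ1, hΨ2, hΨ3⟩ := exists_backgroundMap_of_scheme (Λ := 0) h𝒢 hΛ hW hWa hB₀ hC₄ le_rfl ha hε₄ hdom
    hself' hcontr' H₁ hR hTd hT0 hq hTlip' hR'0 hR'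
  refine ⟨T, Xs, hTsol, fun 𝔄 h𝔄 => ?_, hXa, hX0, hΨ1, hΨ2, hΨ3⟩
  obtain ⟨hn, hfix, huniq⟩ := hXs 𝔄 h𝔄
  exact ⟨hn, (fixed_iff_175 _).1 hfix, fun X' hX' hX'eq => huniq X' hX' ((fixed_iff_175 _).2 hX'eq)⟩

/-! ## §3 On finite-dimensional configuration spaces the analyticity hypothesis is `Prop4Hyp` (Osgood) -/

/-- [folklore] **On a finite-dimensional `𝒴`** — every configuration space of a finite lattice — the hypothesis `AnalyticOnNhd ℂ W {‖Y‖ < a₃}`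
of §1–§2 IS `B11Prop6Scheme.Prop4Hyp`'s Fréchet-differentiability clause (Osgood's lemma — stated in the tree for a complete codomain, here
`𝒵` complete, automatic on the lattice — tree
`Literature.Analysis.Complex.SCV.analyticOnNhd_of_differentiableOn`); so on such spaces §1–§2′ ask nothing beyond the scheme
(feed `hW.quadAnalytic` and this to `exists_analyticOnNhd_solution` ∕ `exists_backgroundMap_of_twoSchemes`). -/
theorem analyticOnNhd_of_prop4Hyp [FiniteDimensional ℂ 𝒴] [CompleteSpace 𝒵] (hW : Prop4Hyp W C₄ a₃) :
    AnalyticOnNhd ℂ W {Y : 𝒴 | ‖Y‖ < a₃} :=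
  Literature.Analysis.Complex.SCV.analyticOnNhd_of_differentiableOn hW.differentiableOn
    (isOpen_lt continuous_norm continuous_const)

end Summit.QuantumFields.BalabanUV.T4Continuum.NE9B11SolutionAnalytic

end
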